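import Summits.HubbardSuperconductivity.HubbardSuperconductivity.Theorems.LevyLogBootstrapDressHalfFilledDictionaryExhaustion
import Summits.HubbardSuperconductivity.HubbardSuperconductivity.Theorems.LevyLogBootstrapDressHalfFilledDictionaryPairField
import HarnessLib

/-!
# Route `LevyLogBootstrap` / `AnisotropyChord`, crux `DressHalfFilled` (stmt-HubbardSuperconductivity-8148), stub 2
# `stub_plaquetteDictionary`: ASSEMBLY of the dictionary from its clauses, modulo the kernel clause (d)

Support file (`--supports stmt-HubbardSuperconductivity-8148`). The body of the skeleton's `PlaquetteDictionary U`
(`Cruxes/DressHalfFilled/Lines/birth.lean`) asks, for every side `L = 2M ≥ 8` with `4 ∣ L`, for an isometry `Φ` of the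
`S = ½` plaquette-torus space into the electron Fock space with (a) `Φᴴ Φ = 1`, (b) spin sector `S^z = N_b − M²/2` ↦
electron sector `((2M)² − 2N_b, 0)` inside the `E₀(N_b)`-eigenspace of the intra-plaquette Hamiltonian, (c) exhaustion
of that sector ground space, (d) Kato's kernel `T S(E₀) T` pulls back to `-(2J·XXZ(Δ_eff) + k(N_b))`, (e)
`Φᴴ Δ_d Φ = c Σ_R S⁺_R`.

For the tree's map `Φ = TorusPlaquette.dictionaryMap M U` clauses (a), (b) are the Literature theorems
`dictionaryMap_conjTranspose_mul_self`, `dictionaryMap_mulVec_mem_szSector`,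
`hamiltonian_intra_mulVec_dictionaryMap_mulVec` (`TorusPlaquetteDictionaryMap`), clause (c) is
`dictionary_exhaustion` (`…DictionaryExhaustion`, from the plaquette data (W3)–(W5)) and clause (e) is
`dictionaryMap_conjTranspose_mul_pairField_mul` (`…DictionaryPairField`). This file ASSEMBLES them:
`dictionaryOfKernel` — given (W3)–(W5) at `U` and clause (d) for `dictionaryMap M U` on every even `M ≥ 4` (an
explicit hypothesis; its proof is the two-cluster locality chain `…KernelXXZBondSum` → inter-plaquette locality), the
body of `PlaquetteDictionary U` holds with `Φ := dictionaryMap M U` (`L = 2M`, `8 ≤ L`, `4 ∣ L` give `4 ≤ M`, `M` even).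
The registered sub-goal `dressHalfFilled_dictionaryOfKernel` (signature verbatim as registered on the item) is the
closed form.

References: W.-F. Tsai, S. A. Kivelson, PRB 73 (2006) 214510, App. A (A1) [TsaiKivelson2006]; H. Yao, W.-F. Tsai,
S. A. Kivelson, PRB 76 (2007) 161104(R), eq. (2) [YaoTsaiKivelson2007]; T. Kato (1966) II-§2.2. All statements are
[folklore] bookkeeping; no definition and no named fact is introduced.
-/

set_option linter.dupNamespace false

noncomputable section

namespace Summit.HubbardSuperconductivity.HubbardSuperconductivity.Theorems.LevyLogBootstrap

open Matrix Finset Literature.MathematicalPhysics.QuantumLattice Literature.Probability.LatticeModels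
open Literature.MathematicalPhysics.QuantumLattice.TorusPlaquette
open scoped ComplexOrder

/-- `L = 2M`, `8 ≤ L`, `4 ∣ L` ⇒ `4 ≤ M` and `M` even. [bookkeeping] -/
theorem four_le_and_even_of_side {L M : ℕ} (hLM : L = 2 * M) (h8 : 8 ≤ L) (h4 : 4 ∣ L) : 4 ≤ M ∧ Even M := by
  subst hLM
  refine ⟨by omega, ?_⟩
  obtain ⟨c, hc⟩ := h4
  exact ⟨c, by omega⟩

/-- **Assembly of the plaquette-boson dictionary for `Φ = dictionaryMap M U`, modulo the kernel clause (d).** On the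
checkerboard torus of side `2M`, `M ≥ 2`, with the plaquette data (W3)–(W5) at `U` and the kernel pull-back (d) for
`dictionaryMap M U` given as a hypothesis `hd`, the five clauses (a)–(e) of `PlaquetteDictionary U` hold for
`Φ := dictionaryMap M U`. [cite: TsaiKivelson2006, App. A (A1)] -/
theorem dictionaryOfKernel {M : ℕ} [NeZero M] (hM : 2 ≤ M) (U : ℝ)
    (hW3 : ∀ n : ℕ, n ≤ 8 → n ≠ 2 → n ≠ 4 →
      (4 - (n : ℝ)) * groundEnergyAt plaquetteGraph 1 U 2 + ((n : ℝ) - 2) * groundEnergyAt plaquetteGraph 1 U 4 <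
        2 * groundEnergyAt plaquetteGraph 1 U n)
    (hW4a : ∀ φ₁ φ₂ : Fock (Orb PlaquetteSite), IsGroundStateInSector (plaquetteHamiltonian U) 4 0 φ₁ →
      IsGroundStateInSector (plaquetteHamiltonian U) 4 0 φ₂ → ∃ a : ℂ, φ₂ = a • φ₁)
    (hW4b : ∀ φ₁ φ₂ : Fock (Orb PlaquetteSite), IsGroundStateInSector (plaquetteHamiltonian U) 2 0 φ₁ →
      IsGroundStateInSector (plaquetteHamiltonian U) 2 0 φ₂ → ∃ a : ℂ, φ₂ = a • φ₁)
    (hW5a : ∀ m : ℝ, m = 1 ∨ m = -1 ∨ m = 2 ∨ m = -2 →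
      (plaquetteHamiltonian U).minEnergyOn (szSector 4 0) < (plaquetteHamiltonian U).minEnergyOn (szSector 4 m))
    (hW5b : ∀ m : ℝ, m = 1 ∨ m = -1 →
      (plaquetteHamiltonian U).minEnergyOn (szSector 2 0) < (plaquetteHamiltonian U).minEnergyOn (szSector 2 m))
    (hd : ∃ k : ℕ → ℝ, ∀ Nb : ℕ, Nb ≤ M ^ 2 → ∀ φ φ' : TensorIndex (TorusSite 2 M) 2 → ℂ,
      φ ∈ spinZSector (Λ := TorusSite 2 M) 1 ((Nb : ℝ) - (M : ℝ) ^ 2 / 2) →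
      φ' ∈ spinZSector (Λ := TorusSite 2 M) 1 ((Nb : ℝ) - (M : ℝ) ^ 2 / 2) →
      star (TorusPlaquette.dictionaryMap M U *ᵥ φ') ⬝ᵥ ((hamiltonian ((fermionTorusGraph 2 (2 * M)) ⊓
        SimpleGraph.comap (fun x : FermionTorus 2 (2 * M) => fun i : Fin 2 => ((ofLex x) i : ℕ) / 2) ⊤) 1 0 *
        reducedResolvent (hamiltonian ((fermionTorusGraph 2 (2 * M)) \
          SimpleGraph.comap (fun x : FermionTorus 2 (2 * M) => fun i : Fin 2 => ((ofLex x) i : ℕ) / 2) ⊤) 1 U)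
          (((M : ℝ) ^ 2 - (Nb : ℝ)) * (plaquettePairCouplings U).E 0 + (Nb : ℝ) * (plaquettePairCouplings U).E 2) *
        hamiltonian ((fermionTorusGraph 2 (2 * M)) ⊓
          SimpleGraph.comap (fun x : FermionTorus 2 (2 * M) => fun i : Fin 2 => ((ofLex x) i : ℕ) / 2) ⊤) 1 0) *ᵥ
        (TorusPlaquette.dictionaryMap M U *ᵥ φ)) =
      -(star φ' ⬝ᵥ ((((2 * (plaquettePairCouplings U).J : ℝ) : ℂ) •
        xxzHamiltonian 1 (torusGraph 2 M) (-1) (plaquettePairCouplings U).ΔEff + ((k Nb : ℝ) : ℂ) • 1) *ᵥ φ))) :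
    let C := plaquettePairCouplings U
    let Hin := hamiltonian ((fermionTorusGraph 2 (2 * M)) \ SimpleGraph.comap
      (fun x : FermionTorus 2 (2 * M) => fun i : Fin 2 => ((ofLex x) i : ℕ) / 2) ⊤) 1 U
    let T := hamiltonian ((fermionTorusGraph 2 (2 * M)) ⊓ SimpleGraph.comap
      (fun x : FermionTorus 2 (2 * M) => fun i : Fin 2 => ((ofLex x) i : ℕ) / 2) ⊤) 1 0
    let E₀ : ℕ → ℝ := fun Nb => ((M : ℝ) ^ 2 - (Nb : ℝ)) * C.E 0 + (Nb : ℝ) * C.E 2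
    (dictionaryMap M U)ᴴ * dictionaryMap M U = 1 ∧
      (∀ Nb : ℕ, Nb ≤ M ^ 2 → ∀ φ : TensorIndex (TorusSite 2 M) 2 → ℂ,
        φ ∈ spinZSector (Λ := TorusSite 2 M) 1 ((Nb : ℝ) - (M : ℝ) ^ 2 / 2) →
        dictionaryMap M U *ᵥ φ ∈ szSector (Λ := FermionTorus 2 (2 * M)) ((2 * M) ^ 2 - 2 * Nb) 0 ∧
        Hin *ᵥ (dictionaryMap M U *ᵥ φ) = ((E₀ Nb : ℝ) : ℂ) • (dictionaryMap M U *ᵥ φ)) ∧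
      (∀ Nb : ℕ, Nb ≤ M ^ 2 →
        Hin.minEnergyOn (szSector (Λ := FermionTorus 2 (2 * M)) ((2 * M) ^ 2 - 2 * Nb) 0) = E₀ Nb ∧
        ∀ ψ : Fock (Orb (FermionTorus 2 (2 * M))), ψ ∈ szSector (Λ := FermionTorus 2 (2 * M)) ((2 * M) ^ 2 - 2 * Nb) 0 →
          Hin *ᵥ ψ = ((E₀ Nb : ℝ) : ℂ) • ψ →
          ∃ φ : TensorIndex (TorusSite 2 M) 2 → ℂ,
            φ ∈ spinZSector (Λ := TorusSite 2 M) 1 ((Nb : ℝ) - (M : ℝ) ^ 2 / 2) ∧ ψ = dictionaryMap M U *ᵥ φ) ∧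
      (∃ k : ℕ → ℝ, ∀ Nb : ℕ, Nb ≤ M ^ 2 → ∀ φ φ' : TensorIndex (TorusSite 2 M) 2 → ℂ,
        φ ∈ spinZSector (Λ := TorusSite 2 M) 1 ((Nb : ℝ) - (M : ℝ) ^ 2 / 2) →
        φ' ∈ spinZSector (Λ := TorusSite 2 M) 1 ((Nb : ℝ) - (M : ℝ) ^ 2 / 2) →
        star (dictionaryMap M U *ᵥ φ') ⬝ᵥ ((T * reducedResolvent Hin (E₀ Nb) * T) *ᵥ (dictionaryMap M U *ᵥ φ)) =
          -(star φ' ⬝ᵥ ((((2 * C.J : ℝ) : ℂ) • xxzHamiltonian 1 (torusGraph 2 M) (-1) C.ΔEff +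
            ((k Nb : ℝ) : ℂ) • 1) *ᵥ φ))) ∧
      (dictionaryMap M U)ᴴ * pairField dWaveFormFactor (2 * M) * dictionaryMap M U =
        ((C.c : ℝ) : ℂ) • ∑ R : TorusSite 2 M, onSite R (spinRaise 1) := by
  intro C Hin T E₀
  refine ⟨dictionaryMap_conjTranspose_mul_self U, fun Nb hNb φ hφ => ⟨?_, ?_⟩, fun Nb hNb => ?_, ?_, ?_⟩
  · exact dictionaryMap_mulVec_mem_szSector U hNb hφ
  · exact hamiltonian_intra_mulVec_dictionaryMap_mulVec hM U hNb hφ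
  · exact dictionary_exhaustion hM U hW3 hW4a hW4b hW5a hW5b hNb
  · exact hd
  · exact dictionaryMap_conjTranspose_mul_pairField_mul hM U

/-! ### Registered form -/

set_option linter.style.longLine false in
/-- **Registered sub-goal `dressHalfFilled_dictionaryOfKernel`** (closed form, signature verbatim as registered on the
crux item stmt-HubbardSuperconductivity-8148): stub 2 ASSEMBLY modulo clause (d) — the plaquette data (W3)–(W5) at `U`
together with the kernel pull-back (d) for `TorusPlaquette.dictionaryMap M U` on every even `M ≥ 4` imply the body of
`PlaquetteDictionary U` verbatim (witness `Φ = TorusPlaquette.dictionaryMap M U`, `L = 2M`).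
[cite: TsaiKivelson2006, App. A (A1)] -/
theorem dressHalfFilled_dictionaryOfKernel : ∀ (U : ℝ), (∀ n : ℕ, n ≤ 8 → n ≠ 2 → n ≠ 4 → (4 - (n : ℝ)) * groundEnergyAt plaquetteGraph 1 U 2 + ((n : ℝ) - 2) * groundEnergyAt plaquetteGraph 1 U 4 < 2 * groundEnergyAt plaquetteGraph 1 U n) → (∀ φ₁ φ₂ : Fock (Orb PlaquetteSite), IsGroundStateInSector (plaquetteHamiltonian U) 4 0 φ₁ → IsGroundStateInSector (plaquetteHamiltonian U) 4 0 φ₂ → ∃ a : ℂ, φ₂ = a • φ₁) → (∀ φ₁ φ₂ : Fock (Orb PlaquetteSite), IsGroundStateInSector (plaquetteHamiltonian U) 2 0 φ₁ → IsGroundStateInSector (plaquetteHamiltonian U) 2 0 φ₂ → ∃ a : ℂ, φ₂ = a • φ₁) → (∀ m : ℝ, m = 1 ∨ m = -1 ∨ m = 2 ∨ m = -2 → (plaquetteHamiltonian U).minEnergyOn (szSector 4 0) < (plaquetteHamiltonian U).minEnergyOn (szSector 4 m)) → (∀ m : ℝ, m = 1 ∨ m = -1 → (plaquetteHamiltonian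 U).minEnergyOn (szSector 2 0) < (plaquetteHamiltonian U).minEnergyOn (szSector 2 m)) → (∀ (M : ℕ) [NeZero M], 4 ≤ M → Even M → ∃ k : ℕ → ℝ, ∀ Nb : ℕ, Nb ≤ M ^ 2 → ∀ φ φ' : TensorIndex (TorusSite 2 M) 2 → ℂ, φ ∈ spinZSector (Λ := TorusSite 2 M) 1 ((Nb : ℝ) - (M : ℝ) ^ 2 / 2) → φ' ∈ spinZSector (Λ := TorusSite 2 M) 1 ((Nb : ℝ) - (M : ℝ) ^ 2 / 2) → star (TorusPlaquette.dictionaryMap M U *ᵥ φ') ⬝ᵥ ((hamiltonian ((fermionTorusGraph 2 (2 * M)) ⊓ SimpleGraph.comap (fun x : FermionTorus 2 (2 * M) => fun i : Fin 2 => ((ofLex x) i : ℕ) / 2) ⊤) 1 0 * reducedResolvent (hamiltonian ((fermionTorusGraph 2 (2 * M)) \ SimpleGraph.comap (fun x : FermionTorus 2 (2 * M) => fun i : Fin 2 => ((ofLex x) i : ℕ) / 2) ⊤) 1 U) (((M : ℝ) ^ 2 - (Nb : ℝ)) * (plaquettePairCouplings U).E 0 + (Nb : ℝ) * (plaquettePairCouplings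 U).E 2) * hamiltonian ((fermionTorusGraph 2 (2 * M)) ⊓ SimpleGraph.comap (fun x : FermionTorus 2 (2 * M) => fun i : Fin 2 => ((ofLex x) i : ℕ) / 2) ⊤) 1 0) *ᵥ (TorusPlaquette.dictionaryMap M U *ᵥ φ)) = -(star φ' ⬝ᵥ ((((2 * (plaquettePairCouplings U).J : ℝ) : ℂ) • xxzHamiltonian 1 (torusGraph 2 M) (-1) (plaquettePairCouplings U).ΔEff + ((k Nb : ℝ) : ℂ) • 1) *ᵥ φ))) → ∀ (L M : ℕ) [NeZero L] [NeZero M], L = 2 * M → 8 ≤ L → 4 ∣ L → let C := plaquettePairCouplings U; let Hin := hamiltonian ((fermionTorusGraph 2 L) \ SimpleGraph.comap (fun x : FermionTorus 2 L => fun i : Fin 2 => ((ofLex x) i : ℕ) / 2) ⊤) 1 U; let T := hamiltonian ((fermionTorusGraph 2 L) ⊓ SimpleGraph.comap (fun x : FermionTorus 2 L => fun i : Fin 2 => ((ofLex x) i : ℕ) / 2) ⊤) 1 0; let E₀ : ℕ → ℝ := fun Nb => ((M : ℝ) ^ 2 - (Nb : ℝ)) * C.E 0 + (Nb : ℝ)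 * C.E 2; ∃ Φ : Matrix (Finset (Orb (FermionTorus 2 L))) (TensorIndex (TorusSite 2 M) 2) ℂ, Φᴴ * Φ = 1 ∧ (∀ Nb : ℕ, Nb ≤ M ^ 2 → ∀ φ : TensorIndex (TorusSite 2 M) 2 → ℂ, φ ∈ spinZSector (Λ := TorusSite 2 M) 1 ((Nb : ℝ) - (M : ℝ) ^ 2 / 2) → Φ *ᵥ φ ∈ szSector (Λ := FermionTorus 2 L) (L ^ 2 - 2 * Nb) 0 ∧ Hin *ᵥ (Φ *ᵥ φ) = ((E₀ Nb : ℝ) : ℂ) • (Φ *ᵥ φ)) ∧ (∀ Nb : ℕ, Nb ≤ M ^ 2 → Hin.minEnergyOn (szSector (Λ := FermionTorus 2 L) (L ^ 2 - 2 * Nb) 0) = E₀ Nb ∧ ∀ ψ : Fock (Orb (FermionTorus 2 L)), ψ ∈ szSector (Λ := FermionTorus 2 L) (L ^ 2 - 2 * Nb) 0 → Hin *ᵥ ψ = ((E₀ Nb : ℝ) : ℂ) • ψ → ∃ φ : TensorIndex (TorusSite 2 M) 2 → ℂ, φ ∈ spinZSector (Λ := TorusSite 2 M) 1 ((Nb :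 ℝ) - (M : ℝ) ^ 2 / 2) ∧ ψ = Φ *ᵥ φ) ∧ (∃ k : ℕ → ℝ, ∀ Nb : ℕ, Nb ≤ M ^ 2 → ∀ φ φ' : TensorIndex (TorusSite 2 M) 2 → ℂ, φ ∈ spinZSector (Λ := TorusSite 2 M) 1 ((Nb : ℝ) - (M : ℝ) ^ 2 / 2) → φ' ∈ spinZSector (Λ := TorusSite 2 M) 1 ((Nb : ℝ) - (M : ℝ) ^ 2 / 2) → star (Φ *ᵥ φ') ⬝ᵥ ((T * reducedResolvent Hin (E₀ Nb) * T) *ᵥ (Φ *ᵥ φ)) = -(star φ' ⬝ᵥ ((((2 * C.J : ℝ) : ℂ) • xxzHamiltonian 1 (torusGraph 2 M) (-1) C.ΔEff + ((k Nb : ℝ) : ℂ) • 1) *ᵥ φ))) ∧ Φᴴ * pairField dWaveFormFactor L * Φ = ((C.c : ℝ) : ℂ) • ∑ R : TorusSite 2 M, onSite R (spinRaise 1) := by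
  intro U hW3 hW4a hW4b hW5a hW5b hd L M _ _ hLM h8 h4
  obtain ⟨hM4, hMe⟩ := four_le_and_even_of_side hLM h8 h4
  subst hLM
  intro C Hin T E₀
  exact ⟨TorusPlaquette.dictionaryMap M U, dictionaryOfKernel (M := M) (by omega) U hW3 hW4a hW4b hW5a hW5b (hd M hM4 hMe)⟩

end Summit.HubbardSuperconductivity.HubbardSuperconductivity.Theorems.LevyLogBootstrap

end
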